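import Mathlib.RepresentationTheory.Homological.ContCohomology.Functoriality
import Literature.AnabelianGeometry.AbsoluteAnabelian.AbsTopIThm26iii
import HarnessLib

/-!
# [AbsTopI] Thm 2.6: the invariants `δʲ_l`, `εʲ_l`, `θʲ` and item (iii) are "group-theoretic"

S. Mochizuki, *Topics in Absolute Anabelian Geometry I: Generalities* (2012) [AbsTopI], Thm 2.6,
manuscript pp. 21–22 (lit key `paper:url-11ac98ba15fc`): the invariants
"`δʲ_l(H) := dim_{ℚ_l}(Hʲ(H, ℚ_l))`, `εʲ_l(Π) := sup_{J ⊆ Π} {δʲ_l(J)}`, `θʲ(Π) := {l | εʲ_l(Π) ≥ 3 − j}`"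
enter (iii)–(v) as "group-theoretic" data ("since '`θ²(−)`', [...] are 'group-theoretic'", (v)
p. 22), i.e. they depend only on the isomorphism class of the TOPOLOGICAL GROUP.

PROOF-ONLY companion of abc-iut-L4-t4's `AbsTopIThm26iii.lean` (p416241: `deltaInv`, `epsilonInv`,
`thetaSet`, `FundamentalExtension.Thm26iii`), making that kernel-explicit: for an isomorphism of
topological groups `e : G ≃ₜ* H` (same universe),
* `rank_continuousCohomology_trivial_eq_of_continuousMulEquiv` — `Hʲ_cont(G, ℚ_l) ≅ Hʲ_cont(H, ℚ_l)`
  (trivial coefficients) have the same `ℚ_l`-rank: the maps induced by `e` and `e⁻¹` on Mathlib's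
  `continuousCohomology` (`ContinuousCohomology.map`) are mutually inverse by `map_comp`/`map_id`;
* `deltaInv_eq_of_continuousMulEquiv`, `epsilonInv_eq_of_continuousMulEquiv` (open subgroups
  correspond under `e`, with `J ≃ₜ* e(J)`), `thetaSet_eq_of_continuousMulEquiv`;
* `FundamentalExtension.thm26iii_iff_of_continuousMulEquiv` — the typed (iii) is invariant under
  `Π_E ≃ₜ* Π_F`.
HONEST FRAMING: bookkeeping over a refereed paper's definitions; nothing here bears on [IUTchIII]
Cor. 3.12.
-/

noncomputable section

open CategoryTheory

namespace Literature.AnabelianGeometry.AbsoluteAnabelian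

universe u

variable {G H : Type u} [Group G] [TopologicalSpace G] [IsTopologicalGroup G]
  [Group H] [TopologicalSpace H] [IsTopologicalGroup H]

/-- `ContinuousCohomology.map` along (a map equal to) the identity of the group and a pointwise
identity of coefficients is the identity (Mathlib `map_id` after substitution). [folklore] -/
private theorem continuousCohomology_map_eq_id' {k : Type*} [Ring k] [TopologicalSpace k]
    {X : TopRep k H} (θ : H →ₜ* H) (F : TopRep.res (θ : H →* H) X ⟶ X)
    (hθ : θ = ContinuousMonoidHom.id H) (hF : ∀ x : X, F.hom x = x) (q : ℕ) :
    ContinuousCohomology.map θ F q = 𝟙 _ := by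
  subst hθ
  have : F = 𝟙 X :=
    TopRep.hom_ext (ContIntertwiningMap.ext (ContinuousLinearMap.ext fun x => hF x))
  rw [this]
  exact ContinuousCohomology.map_id X q

/-- **`Hʲ_cont(G, ℚ_l) ≅ Hʲ_cont(H, ℚ_l)` along `e : G ≃ₜ* H`** (trivial coefficients): equal
`ℚ_l`-ranks — the maps induced on Mathlib's continuous cohomology by `e⁻¹` and `e` (with the identity
on coefficients) compose to the identity both ways. [cite: MochizukiAbsTopI2012, Thm 2.6 p.21] -/
theorem rank_continuousCohomology_trivial_eq_of_continuousMulEquiv (e : G ≃ₜ* H) (l : ℕ)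
    [Fact l.Prime] (j : ℕ) :
    Module.rank ℚ_[l] (continuousCohomology j
        (TopRep.of (ContRepresentation.trivial ℚ_[l] G (ULift.{u} ℚ_[l])))) =
      Module.rank ℚ_[l] (continuousCohomology j
        (TopRep.of (ContRepresentation.trivial ℚ_[l] H (ULift.{u} ℚ_[l])))) := by
  -- coefficients: the identity of `ULift ℚ_l` in both directions
  let f : TopRep.res ((e.symm : H →ₜ* G) : H →* G)
      (TopRep.of (ContRepresentation.trivial ℚ_[l] G (ULift.{u} ℚ_[l]))) ⟶
        TopRep.of (ContRepresentation.trivial ℚ_[l] H (ULift.{u} ℚ_[l])) :=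
    TopRep.ofHom ⟨ContinuousLinearMap.id ℚ_[l] (ULift.{u} ℚ_[l]), fun _ => by
      ext v
      rfl⟩
  let g : TopRep.res ((e : G →ₜ* H) : G →* H)
      (TopRep.of (ContRepresentation.trivial ℚ_[l] H (ULift.{u} ℚ_[l]))) ⟶
        TopRep.of (ContRepresentation.trivial ℚ_[l] G (ULift.{u} ℚ_[l])) :=
    TopRep.ofHom ⟨ContinuousLinearMap.id ℚ_[l] (ULift.{u} ℚ_[l]), fun _ => by
      ext v
      rfl⟩
  have hcomp₁ : ContinuousCohomology.map (e.symm : H →ₜ* G) f j ≫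
      ContinuousCohomology.map (e : G →ₜ* H) g j = 𝟙 _ := by
    rw [← ContinuousCohomology.map_comp]
    refine continuousCohomology_map_eq_id' _ _ ?_ (fun x => rfl) j
    ext x
    simp
  have hcomp₂ : ContinuousCohomology.map (e : G →ₜ* H) g j ≫
      ContinuousCohomology.map (e.symm : H →ₜ* G) f j = 𝟙 _ := by
    rw [← ContinuousCohomology.map_comp]
    refine continuousCohomology_map_eq_id' _ _ ?_ (fun x => rfl) j
    ext x
    simp
  have key₁ : ∀ x, (ContinuousCohomology.map (e : G →ₜ* H) g j).hom
      ((ContinuousCohomology.map (e.symm : H →ₜ* G) f j).hom x) = x := fun x => by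
    have hx := congr_arg (fun φ => φ.hom x) hcomp₁
    simpa using hx
  have key₂ : ∀ y, (ContinuousCohomology.map (e.symm : H →ₜ* G) f j).hom
      ((ContinuousCohomology.map (e : G →ₜ* H) g j).hom y) = y := fun y => by
    have hy := congr_arg (fun φ => φ.hom y) hcomp₂
    simpa using hy
  exact (LinearEquiv.ofLinear
    (ContinuousCohomology.map (e.symm : H →ₜ* G) f j).hom.toLinearMap
    (ContinuousCohomology.map (e : G →ₜ* H) g j).hom.toLinearMap
    (LinearMap.ext key₂) (LinearMap.ext key₁)).rank_eq

/-- **`δʲ_l` is an invariant of the topological group**: `δʲ_l(G) = δʲ_l(H)` for `G ≃ₜ* H`.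
[cite: MochizukiAbsTopI2012, Thm 2.6 p.21] -/
theorem deltaInv_eq_of_continuousMulEquiv (e : G ≃ₜ* H) (j l : ℕ) [Fact l.Prime] :
    deltaInv G j l = deltaInv H j l := by
  unfold deltaInv
  rw [rank_continuousCohomology_trivial_eq_of_continuousMulEquiv e l j]

omit [IsTopologicalGroup G] [IsTopologicalGroup H] in
/-- An open subgroup `J ⊆ G` is isomorphic, as a topological group, to its image `e(J) ⊆ H` under
an isomorphism of topological groups `e : G ≃ₜ* H`. [folklore] -/
private theorem exists_subgroup_map_equiv (e : G ≃ₜ* H) (J : Subgroup G) :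
    Nonempty (J ≃ₜ* (J.map (e : G →* H))) := by
  have hmem : ∀ x : J, e (x : G) ∈ J.map (e : G →* H) := fun x =>
    Subgroup.mem_map_of_mem (e : G →* H) x.2
  have hmem' : ∀ y : J.map (e : G →* H), e.symm (y : H) ∈ J := fun y => by
    obtain ⟨x, hx, hxy⟩ := Subgroup.mem_map.mp y.2
    have h : e.symm (y : H) = x := by
      rw [← hxy]
      exact e.symm_apply_apply x
    rw [h]
    exact hx
  refine ⟨{ toFun := fun x => ⟨e (x : G), hmem x⟩
            invFun := fun y => ⟨e.symm (y : H), hmem' y⟩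
            left_inv := fun x => Subtype.ext (e.symm_apply_apply (x : G))
            right_inv := fun y => Subtype.ext (e.apply_symm_apply (y : H))
            map_mul' := fun x y => Subtype.ext
              (show e ((x : G) * (y : G)) = e (x : G) * e (y : G) from map_mul e _ _)
            continuous_toFun := ?_
            continuous_invFun := ?_ }⟩
  · apply Continuous.subtype_mk
    exact e.continuous.comp continuous_subtype_val
  · apply Continuous.subtype_mk
    exact e.symm.continuous.comp continuous_subtype_val

omit [IsTopologicalGroup G] [IsTopologicalGroup H] in
/-- The image of an open subgroup under an isomorphism of topological groups is open. [folklore] -/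
private theorem isOpen_subgroup_map (e : G ≃ₜ* H) {J : Subgroup G} (hJ : IsOpen (J : Set G)) :
    IsOpen ((J.map (e : G →* H)) : Set H) := by
  rw [Subgroup.coe_map]
  exact e.toHomeomorph.isOpenMap _ hJ

/-- `εʲ_l(G) ≤ εʲ_l(H)` along `e : G ≃ₜ* H` (each open `J ⊆ G` has the open partner `e(J) ⊆ H` with
the same `δʲ_l`). [cite: MochizukiAbsTopI2012, Thm 2.6 p.21] -/
theorem epsilonInv_le_of_continuousMulEquiv (e : G ≃ₜ* H) (j l : ℕ) [Fact l.Prime] :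
    epsilonInv G j l ≤ epsilonInv H j l := by
  unfold epsilonInv
  refine iSup₂_le fun J hJ => ?_
  obtain ⟨eJ⟩ := exists_subgroup_map_equiv e J
  rw [deltaInv_eq_of_continuousMulEquiv eJ j l]
  exact le_iSup₂_of_le (J.map (e : G →* H)) (isOpen_subgroup_map e hJ) le_rfl

/-- **`εʲ_l` is an invariant of the topological group**: `εʲ_l(G) = εʲ_l(H)` for `G ≃ₜ* H`.
[cite: MochizukiAbsTopI2012, Thm 2.6 p.21] -/
theorem epsilonInv_eq_of_continuousMulEquiv (e : G ≃ₜ* H) (j l : ℕ) [Fact l.Prime] :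
    epsilonInv G j l = epsilonInv H j l :=
  le_antisymm (epsilonInv_le_of_continuousMulEquiv e j l)
    (epsilonInv_le_of_continuousMulEquiv e.symm j l)

/-- **`θʲ` is an invariant of the topological group** ("'`θ²(−)`' [is] 'group-theoretic'", Thm 2.6
(v) p. 22): `θʲ(G) = θʲ(H)` for `G ≃ₜ* H`. [cite: MochizukiAbsTopI2012, Thm 2.6 (v) p.22] -/
theorem thetaSet_eq_of_continuousMulEquiv (e : G ≃ₜ* H) (j : ℕ) : thetaSet G j = thetaSet H j := by
  ext l
  refine exists_congr fun hl => ?_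
  rw [@epsilonInv_eq_of_continuousMulEquiv G H _ _ _ _ _ _ e j l ⟨hl⟩]

namespace FundamentalExtension

/-- **[AbsTopI] Thm 2.6 (iii) is "group-theoretic"**: for extensions `E`, `F` with isomorphic
arithmetic fundamental groups `Π_E ≃ₜ* Π_F`, the typed predicate `Thm26iii` (for the same
construction-data prime set) holds for `E` iff it holds for `F`.
[cite: MochizukiAbsTopI2012, Thm 2.6 (iii) p.22] -/
theorem thm26iii_iff_of_continuousMulEquiv (E F : FundamentalExtension.{u})
    (e : E.arith ≃ₜ* F.arith) (S : Set ℕ) : E.Thm26iii S ↔ F.Thm26iii S := by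
  unfold Thm26iii
  rw [thetaSet_eq_of_continuousMulEquiv e 2, thetaSet_eq_of_continuousMulEquiv e 1]

end FundamentalExtension

end Literature.AnabelianGeometry.AbsoluteAnabelian
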